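import Literature.MathematicalPhysics.QuantumFieldTheory.Balaban1983to89.Node00.LocalGaugeCoDivergence
import HarnessLib

/-!
# N07 [B11] (= [15] = [Balaban1985Variational]) Sect. F, road of record R0′, WIDTH-209 row (r2): **A CURL-FREE (PURE-GAUGE) SUMMAND OF THE POTENTIAL IS
# INVISIBLE TO THE LINEAR PARTS OF THE CLASS (2)** — print's last step (168) «(167) and the inequality (1.54) of [6] imply |U₁(∂p) − 1| < ε′ + 86dε′²»
# AT NODE 00's objects WITH THE CURL ISOLATED: if `(ι∘U)^{ι∘u} = e^{iξ(A₀ + G)}` on a site set `Y` with `G` curl-free (e.g. `G = ∇^ξm`, the fine pure gauge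
# `∂μ = H(∂_cλ)` absorbing the axial→Landau shear of road R0′), then the plaquette member (1.7) and the co-divergence member (1.9) of (2) inside `Y` are
# bounded by the `∇^ξ`∕`∂^{ξ*}∂^ξ` letters of `A₀` ALONE at first order, the full potential `A₀ + G` entering only through the quadratic term:
# `|U(∂p) − 1| < (2t₀ + 24t²)·ξ²`, `‖η·(D*∂U)(b)‖ < (t₀ + 32d·t²)·ξ³`

Cell `pub-ymgap`, width seat `pub-ymgap-dag-n07-w8` g0 (director-ym R405 ∕ №209 second wave), WIDTH-209 N07 row (r2) of the road of record R0′ (plan g83 WORDS-2; lane owner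
dag-n07-e g19 I.29609∕I.29900: «(r2) the `∂μ`-shift of the non-invariant letters of (164)∕(167) at O(ε₀); (168)'s invariant norms `|U₁(∂p) − 1|`, `|D*∂U₁|` touched only
through (1.54)'s `86dε′²`»; dag-n07-w7 g0 `ROAD-CHECK-R4-R0prime.md` (B)(ii)).  `--kind proof --supports stmt-QuantumFields-20542 --as helper`; count-neutral.
[15] = T. Bałaban, *The variational problem and background fields in renormalization group method for lattice gauge theories*, Commun. Math. Phys. **102** (1985)
277–309 [Balaban1985Variational]; [6] = T. Bałaban, *Spaces of regular gauge field configurations on a lattice and gauge fixing conditions*, Commun. Math. Phys. **99**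
(1985) 75–102 [Balaban1985RegularSpaces]; [B9] = *Propagators for lattice gauge theories in a background field*, CMP **99** (1985) 389–434 [Balaban1985BackgroundPropagators].

THE PRINT.  [15] p. 304 (168): *«Now let us draw conclusions concerning the regularity of U′_k from the above inequality. We take Δ = Δ₀, hence M_Δ = 1, M′ = 1, and we
have this inequality with ε′ = ¼max{B₃ε₁, ½ε₀} on the right-hand side. This and the inequality (1.54) of [6] imply |U₁(∂p) − 1| < ε′ + 86dε′² < 2ε′ on Δ₀ (168) for
ε′ small, similarly for |D*∂U₁ − …|. Again using the fact that U₁ is a gauge transformed U′_k on Δ₀ and that the conditions (2) are gauge invariant, we conclude that U′_k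
satisfies (2) on Δ₀ with max{B₃ε₁, ½ε₀} instead of ε₀.»*; p. 278 (2): *«|(∂U)(p) − 1| < ε₀L⁻²ʲ …, |(D*_U∂U)(b)| < ε₀η²(Lʲη)⁻³ for b ∈ Ω_j»*.  [B9] p. 391 (3.4)∕(3.6):
*«(D^η_{U₀}A)(p_{μν}(x)) = (D^η_{U₀,μ}A_ν)(x) − (D^η_{U₀,ν}A_μ)(x) … A(x,y) + R(U₀(x,y))A(y,z) + R(U₀(x,w))A(z,w) + A(w,x) = η(D^η_{U₀}A)(p)»* — at `U₀ ≡ 1` the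
exponent sum of a plaquette is `iξ·ξ·(∂^ξA)(p)` (tree: `Sect2.sum_plaqExponents`), and the lattice curl of a lattice gradient vanishes identically.  WHY THIS ROW (road R0′,
plan g83 WORDS-2 ∕ n07-w7 (B)): the record's potential differs from print's by the fine pure gauge `∂μ = H(∂_cλ)` of size O(ε₀) with a LARGE coefficient (the shear of [6]
Thm 2's `u`, (152) p. 301); entering module 31's `32·t·ξ²` LINEARLY it would spoil the halving; entering only the quadratic term it is absorbed by a (166)-type smallness of ε₀.

WHAT IS PROVED (sorry-free; no definition; axioms standard).  `P : Params`, `SU(N)`-valued configurations, `M_N(ℂ)`-valued potentials, NODE 00's letters `Sect2.curlA`,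
`Sect2.codiffCurlA`, `Sect2.coDivSum`, `Sect2.plaqExponents`, the clauses `PlaqSmallOn`, `Sect2.CoDivSmallOn`, the region structure `Sect2.regionOfSet`, `plaqInside`,
`Sect2.bondsDeep` — all BY NAME; the matrix-exponential bookkeeping is modules 31∕33a∕33b∕33c (`dist1_plaqHol_gaugeAct_SU`, `norm_holonomy_sub_one_le_sum_add`,
`Sect2.plaqMat_gaugeAct_eq_holonomy`, `Sect2.sum_plaqExponents`, `Sect2.norm_coDivSum_le_of_localGauge_letters`) BY NAME.
* §1 (algebra of the letters) `curlA_add`, `codiffCurlA_add` (additivity), `codiffCurlA_eq_zero_of_curlFree` (a curl-free field has zero `∂^{ξ*}∂^ξ`),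
  `curlA_add_eq_of_curlFree` ∕ `codiffCurlA_add_eq_of_curlFree` (`curl(A₀ + G) = curl A₀`, `∂*∂(A₀ + G) = ∂*∂A₀`), ★ `curlA_gradPot_eq_zero` — **`curl ∘ grad = 0` on the
  lattice for MATRIX-valued site functions** (`G⟨z, κ⟩ := ∇^ξ_κ m(z)`; only additive commutativity is used, so no abelian hypothesis).
* §2 ★ `dist1_plaqHol_le_curl_add_tail` — **[6] (1.54) WITH THE CURL ISOLATED**: under the gauge equation on the bonds of `Y` and `‖A‖ < t` there, every `p ∈ plaqInside Y` has
  `|U(∂p) − 1| ≤ ξ²·‖(∂^ξA)(p)‖ + expTail 2 (4ξt)` (`expTail 2 x = eˣ − 1 − x`); ★★ `dist1_plaqHol_lt_of_curlFree_shift` — for `A = A₀ + G`, `G` curl-free, `‖∇^ξA₀‖ < t₀` on the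
  derivative pairs of `Y`, `0 < ξ ≤ 1`, `32t ≤ 1`: `|U(∂p) − 1| < (2t₀ + 24t²)·ξ²`.
* §3 ★★ `norm_coDivSum_lt_of_curlFree_shift` — the co-divergence member: with, in addition, `‖∇^ξA‖ < t` on the pairs and `‖∂^{ξ*}∂^ξA₀‖ < t₀` on the deep bonds,
  `‖η·(D*∂U)(b)‖ < (t₀ + 32·d·t²)·ξ³` on `Sect2.bondsDeep Y` (33c's (1.54) estimate, whose linear term is `ξ³‖∂^{ξ*}∂^ξ(A₀ + G)‖ = ξ³‖∂^{ξ*}∂^ξA₀‖`).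
* §4 ★★★ `regularTwo_of_curlFreeShift` — **BOTH MEMBERS OF (2) INSIDE `Y`**: `PlaqSmallOn (plaqInside Y) ((2t₀ + 24t²)ξ²) U ∧ Sect2.CoDivSmallOn (bondsDeep Y) ((t₀ + 32dt²)ξ³) U`
  — the pure-gauge-shift twin of 33c's `Sect2.regularTwo_of_localGauge10On` (there: one common threshold `t`, thresholds `32tξ²` ∕ `2tξ³`); `regularTwo_of_gradShift` (the
  instance `G = ∇^ξm`).
HONEST SCOPE.  Kernel lemmas on the tree's own objects; they say only «the linear parts of (1.7)∕(1.9) do not see a curl-free summand»; the SIZES (`t` = letters of the full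
potential incl. `∂μ`, `t₀` = (167)'s letters of print's `A₁ + HB − HD(…)`), the (166)-type slack absorbing `24t²` ∕ `32dt²`, the identification `G = H(∂_cλ) = ∂μ` of road R0′
(dag-n07-w7 `…N07FlatHOfCoarseGradient`, row (r1)) and the S6 knit (n07-w4) are NOT here; no token (`LocalLetters165TopStep(Core)`, `HalvingStepTop`, `stub_prop8StepCoP13`)
is discharged; K0⁷ ∕ K1⁷ NOT closed; N07 NOT discharged; counts unmoved (28∕28 · 5∕27); one finite 𝕋⁴ programme at fixed ε — R4-the-rung closes the conditional finite-𝕋⁴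
`BalabanLadder.UV` only; the YM mass gap (Clay) is NOT proved by any of this; nothing continuum ∕ ℝ⁴ ∕ OS.  No `sorry`, no `def`, no `instance`, no `notation`.

RELATED IN THE TREE, NOT DUPLICATED (stem check 2026-08-28T06:12Z: `ls …/Theorems | grep -i PureGaugeShift168` = ∅; `rg 'curlA_add\b|curlA_gradPot|codiffCurlA_eq_zero_of_curlFree|
dist1_plaqHol_le_curl_add_tail|regularTwo_of_curlFreeShift'` = ∅): n07-w4's three-term splittings `N07HalvingStepTopOfLocalLetters.curlA_add_sub` ∕ `codiffCurlA_add_sub` (cited; the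
two-term additivity is re-derived from the definitions in two lines), route `UnitScaleTilt`'s `Prop7TrueLinPureGauge*` (pure gauges through the LINEARISED AVERAGING — a different
object), `Node00/WilsonActionSecondVariationGauge.*pureGauge*` (the action Hessian — a different object), `Node00/ShearedAveragingPureGauge` (module 42: the sheared average of a
pure gauge — the (r0) naming row).

References: [15] (2) p. 278, (152)–(153) p. 301, (164)–(168) pp. 303–304; [6] (1.2) p. 76, (1.7)–(1.9) p. 77, (1.54) p. 85, Prop. 7 (1.140)–(1.144) p. 100; [B9] (3.4)–(3.6) p. 391.
-/

noncomputable section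

open scoped Matrix.Norms.L2Operator

namespace Summit.QuantumFields.YangMills.BalabanUVNodes.N07PureGaugeShift168

open Complex (I)
open NormedSpace
open Literature.MathematicalPhysics.QuantumFieldTheory.Balaban1983to89
open Literature.MathematicalPhysics.QuantumFieldTheory.Balaban1983to89.Node00
open Literature.MathematicalPhysics.QuantumFieldTheory.Balaban1983to89.Beta.TransportVertices
  (holonomy size expTail expTail_mono expTail_two_le expTail_nonneg size_nonneg size_le_length_mul)
open B15DeterminingSets
open B12RegularSpaces111 (gaugeU expI grad)

variable {P : Params} {N : ℕ}

/-! ## §1  Algebra of the letters: additivity, `curl ∘ grad = 0`, curl-free summands drop out of `∂^ξ` and `∂^{ξ*}∂^ξ` -/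

section Algebra

variable {j : ℕ}

/-- `∇^ξ_μ (F + F′) = ∇^ξ_μ F + ∇^ξ_μ F′` (the lattice derivative is additive). [cite: Balaban1987RG1, (1.12) p.262 (bookkeeping)] -/
theorem grad_add (ξ : ℝ) (μ : Fin P.d) (F F' : Site P j → MatA N) (x : Site P j) :
    grad ξ μ (fun z => F z + F' z) x = grad ξ μ F x + grad ξ μ F' x := by
  simp only [grad, smul_sub, smul_add]
  abel

/-- **`∂^ξ(A + B) = ∂^ξA + ∂^ξB`** (the field strength at the trivial background is additive). [cite: Balaban1985BackgroundPropagators, (3.4) p.391 (bookkeeping)] -/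
theorem curlA_add (ξ : ℝ) (A B : PBond P j → MatA N) (y : Site P j) (ν μ : Fin P.d) :
    Sect2.curlA ξ (A + B) y ν μ = Sect2.curlA ξ A y ν μ + Sect2.curlA ξ B y ν μ := by
  simp only [Sect2.curlA, grad, Pi.add_apply, smul_sub, smul_add]
  abel

/-- **`∂^{ξ*}∂^ξ(A + B) = ∂^{ξ*}∂^ξA + ∂^{ξ*}∂^ξB`**. [cite: Balaban1985RegularSpaces, (1.2) p.76 (bookkeeping)] -/
theorem codiffCurlA_add (ξ : ℝ) (A B : PBond P j → MatA N) (x : Site P j) (μ : Fin P.d) :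
    Sect2.codiffCurlA ξ (A + B) x μ = Sect2.codiffCurlA ξ A x μ + Sect2.codiffCurlA ξ B x μ := by
  simp only [Sect2.codiffCurlA, curlA_add, ← Finset.sum_add_distrib, ← smul_add]
  refine Finset.sum_congr rfl fun ν _ => ?_
  congr 1
  abel

/-- A curl-free bond field has zero co-differential-of-curl `∂^{ξ*}∂^ξ`. [cite: Balaban1985RegularSpaces, (1.2) p.76 (bookkeeping)] -/
theorem codiffCurlA_eq_zero_of_curlFree (ξ : ℝ) {G : PBond P j → MatA N} (hG : ∀ (y : Site P j) (ν μ : Fin P.d), Sect2.curlA ξ G y ν μ = 0)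
    (x : Site P j) (μ : Fin P.d) : Sect2.codiffCurlA ξ G x μ = 0 := by
  simp only [Sect2.codiffCurlA, hG, sub_self, smul_zero, Finset.sum_const_zero]

/-- **A curl-free summand drops out of `∂^ξ`**: `∂^ξ(A₀ + G) = ∂^ξA₀` if `∂^ξG = 0`. [cite: Balaban1985BackgroundPropagators, (3.4) p.391 (bookkeeping)] -/
theorem curlA_add_eq_of_curlFree (ξ : ℝ) (A₀ : PBond P j → MatA N) {G : PBond P j → MatA N}
    (hG : ∀ (y : Site P j) (ν μ : Fin P.d), Sect2.curlA ξ G y ν μ = 0) (y : Site P j) (ν μ : Fin P.d) :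
    Sect2.curlA ξ (A₀ + G) y ν μ = Sect2.curlA ξ A₀ y ν μ := by
  rw [curlA_add, hG, add_zero]

/-- **A curl-free summand drops out of `∂^{ξ*}∂^ξ`**: `∂^{ξ*}∂^ξ(A₀ + G) = ∂^{ξ*}∂^ξA₀` if `∂^ξG = 0`. [cite: Balaban1985RegularSpaces, (1.2) p.76 (bookkeeping)] -/
theorem codiffCurlA_add_eq_of_curlFree (ξ : ℝ) (A₀ : PBond P j → MatA N) {G : PBond P j → MatA N}
    (hG : ∀ (y : Site P j) (ν μ : Fin P.d), Sect2.curlA ξ G y ν μ = 0) (x : Site P j) (μ : Fin P.d) :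
    Sect2.codiffCurlA ξ (A₀ + G) x μ = Sect2.codiffCurlA ξ A₀ x μ := by
  rw [codiffCurlA_add, codiffCurlA_eq_zero_of_curlFree ξ hG, add_zero]

/-- Lattice translations commute: `(x + e_μ) + e_ν = (x + e_ν) + e_μ`. [folklore] -/
private theorem shift_shift_comm (x : Site P j) (μ ν : Fin P.d) : (x.shift μ).shift ν = (x.shift ν).shift μ := by
  funext κ
  by_cases h1 : κ = ν
  · subst h1
    by_cases h2 : κ = μ
    · subst h2; rfl
    · simp [Site.shift, Function.update_of_ne h2]
  · by_cases h2 : κ = μ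
    · subst h2
      simp [Site.shift, Function.update_of_ne h1]
    · simp [Site.shift, Function.update_of_ne h1, Function.update_of_ne h2]

/-- ★ **`curl ∘ grad = 0` ON THE LATTICE, MATRIX-VALUED**: the bond field `G⟨z, κ⟩ := ∇^ξ_κ m(z)` of a site function `m : T → M_N(ℂ)` (a lattice PURE GAUGE at the linear level,
e.g. road R0′'s `∂μ = H(∂_cλ)`) has `(∂^ξG)(p) = 0` at every plaquette: `∇_ν∇_μ m − ∇_μ∇_ν m = 0` by the commutation of lattice translations (only additive commutativity of
`M_N(ℂ)` is used). [cite: Balaban1985BackgroundPropagators, (3.4) p.391; Balaban1985Variational, (168) p.304] -/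
theorem curlA_gradPot_eq_zero (ξ : ℝ) (m : Site P j → MatA N) (y : Site P j) (ν μ : Fin P.d) :
    Sect2.curlA ξ (fun b => grad ξ b.dir m b.src) y ν μ = 0 := by
  simp only [Sect2.curlA, grad, smul_sub, smul_smul]
  rw [shift_shift_comm y ν μ]
  abel

end Algebra

/-! ## §2  [6] (1.54) with the curl isolated: the plaquette member (1.7) -/

section Plaquette

variable [NeZero N]

/-- ★ **[6] (1.54) WITH THE CURL ISOLATED**: under the gauge equation `(ι∘U)^{ι∘u}(b) = e^{iξA(b)}` on the bonds of `Y` and `‖A‖ < t` there (`0 < ξ`), every plaquette with its four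
corners in `Y` has `|U(∂p) − 1| ≤ ξ²·‖(∂^ξA)(p)‖ + expTail 2 (4ξt)`: gauge invariance (module 31), the plaquette variable of `U^u` as the ordered exponential product of the four
exponents (33b), `‖hol − 1‖ ≤ ‖Σ exponents‖ + expTail 2 (Σ‖exponents‖)` (33a) and `Σ exponents = iξ·ξ·(∂^ξA)(p)` (33b ∕ [B9] (3.6)).  The LINEAR term is the lattice curl — it does not
see a curl-free summand of `A`; only the tail does. [cite: Balaban1985RegularSpaces, (1.54) p.85; Balaban1985BackgroundPropagators, (3.4)–(3.6) p.391; Balaban1985Variational, (168) p.304] -/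
theorem dist1_plaqHol_le_curl_add_tail {Y : Set (Site P 0)} {ξ t : ℝ} {u : GaugeTransf P 0 (SU N)} {U : GaugeField P 0 (SU N)} {A : PBond P 0 → MatA N}
    (he : ∀ b ∈ (Sect2.regionOfSet P Y).bonds, gaugeU (fun x => ιSU N (u x)) (fun b' => ιSU N (U b')) b = expI ξ (A b))
    (hA : ∀ b ∈ (Sect2.regionOfSet P Y).bonds, ‖A b‖ < t) (hξ : 0 < ξ) {p : Plaq P 0} (hp : p ∈ plaqInside Y) :
    dist1 (GaugeField.plaqHol U p) ≤ ξ ^ 2 * ‖Sect2.curlA ξ A p.src p.μ p.ν‖ + expTail 2 (4 * (ξ * t)) := by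
  obtain ⟨h1, h2, h3, h4⟩ := hp
  -- gauge invariance and the plaquette variable of `U^u` as an ordered exponential product
  have hP : ((ιSU N (GaugeField.plaqHol (GaugeField.gaugeAct u U) p) : (MatA N)ˣ) : MatA N) = holonomy (Sect2.plaqExponents ξ A p.src p.μ p.ν) :=
    Sect2.plaqMat_gaugeAct_eq_holonomy he p.hμν h1 h2 h3 h4
  rw [← dist1_plaqHol_gaugeAct_SU u U p, dist1_su_eq_norm, ← coe_ιSU, hP]
  refine (norm_holonomy_sub_one_le_sum_add _).trans ?_
  -- the linear vertex is `iξ·ξ·curl`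
  rw [Sect2.sum_plaqExponents hξ.ne', B12Membership314.norm_I_mul_smul hξ.le, norm_smul, Complex.norm_real, Real.norm_of_nonneg hξ.le]
  -- the size of the four exponents
  have hsize : size (Sect2.plaqExponents ξ A p.src p.μ p.ν) ≤ 4 * (ξ * t) := by
    have h := size_le_length_mul (Sect2.plaqExponents ξ A p.src p.μ p.ν) (Sect2.norm_le_of_mem_plaqExponents hξ.le hA h1 h2 h3 h4)
    rw [Sect2.length_plaqExponents] at h
    exact_mod_cast h
  have htail := expTail_mono 2 (size_nonneg _) hsize
  have heq : ξ * (ξ * ‖Sect2.curlA ξ A p.src p.μ p.ν‖) = ξ ^ 2 * ‖Sect2.curlA ξ A p.src p.μ p.ν‖ := by ring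
  rw [heq]
  exact add_le_add le_rfl htail

omit [NeZero N] in
/-- The quadratic tail at the budget `32t ≤ 1`, `0 < ξ ≤ 1`: `expTail 2 (4ξt) ≤ 24·t²·ξ²` (`eˣ − 1 − x ≤ ½x²eˣ`, `x = 4ξt ≤ ⅛`, `e^{1∕8} ≤ e ≤ 3`).
[cite: Balaban1985RegularSpaces, (1.54) p.85 (bookkeeping)] -/
theorem expTail_two_budget {ξ t : ℝ} (hξ : 0 < ξ) (hξ1 : ξ ≤ 1) (ht0 : 0 ≤ t) (ht : 32 * t ≤ 1) :
    expTail 2 (4 * (ξ * t)) ≤ 24 * t ^ 2 * ξ ^ 2 := by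
  have hx0 : 0 ≤ 4 * (ξ * t) := by positivity
  have hx1 : 4 * (ξ * t) ≤ 1 := by nlinarith
  have h1 := expTail_two_le hx0
  have hexp : Real.exp (4 * (ξ * t)) ≤ 3 :=
    (Real.exp_le_exp.mpr hx1).trans (le_of_lt (lt_trans Real.exp_one_lt_d9 (by norm_num)))
  calc expTail 2 (4 * (ξ * t)) ≤ (4 * (ξ * t)) ^ 2 / 2 * Real.exp (4 * (ξ * t)) := h1
    _ ≤ (4 * (ξ * t)) ^ 2 / 2 * 3 := by gcongr
    _ = 24 * t ^ 2 * ξ ^ 2 := by ring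

/-- ★★ **THE PLAQUETTE MEMBER UNDER A CURL-FREE SHIFT**: `(ι∘U)^{ι∘u} = e^{iξ(A₀ + G)}` on the bonds of `Y` with `G` curl-free, `‖A₀ + G‖ < t` on the bonds, `‖∇^ξA₀‖ < t₀` on the
derivative pairs of `Y`, `0 < ξ ≤ 1`, `32t ≤ 1` ⇒ `|U(∂p) − 1| < (2t₀ + 24t²)·ξ²` on `plaqInside Y` — the curl-free summand is seen ONLY by the quadratic term (print: «ε′ + 86dε′²»).
[cite: Balaban1985Variational, (168) p.304, (2) p.278; Balaban1985RegularSpaces, (1.54) p.85] -/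
theorem dist1_plaqHol_lt_of_curlFree_shift {Y : Set (Site P 0)} {ξ t t₀ : ℝ} {u : GaugeTransf P 0 (SU N)} {U : GaugeField P 0 (SU N)} {A₀ G : PBond P 0 → MatA N}
    (he : ∀ b ∈ (Sect2.regionOfSet P Y).bonds, gaugeU (fun x => ιSU N (u x)) (fun b' => ιSU N (U b')) b = expI ξ ((A₀ + G) b))
    (hG : ∀ (y : Site P 0) (ν μ : Fin P.d), Sect2.curlA ξ G y ν μ = 0)
    (hA : ∀ b ∈ (Sect2.regionOfSet P Y).bonds, ‖(A₀ + G) b‖ < t)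
    (hdA₀ : ∀ q ∈ (Sect2.regionOfSet P Y).dpairs, ‖grad ξ q.2.1 (fun y => A₀ ⟨y, q.2.2⟩) q.1‖ < t₀)
    (hξ : 0 < ξ) (hξ1 : ξ ≤ 1) (ht : 32 * t ≤ 1) {p : Plaq P 0} (hp : p ∈ plaqInside Y) :
    dist1 (GaugeField.plaqHol U p) < (2 * t₀ + 24 * t ^ 2) * ξ ^ 2 := by
  have hmain := dist1_plaqHol_le_curl_add_tail he hA hξ hp
  obtain ⟨h1, h2, h3, h4⟩ := hp
  have ht0 : 0 ≤ t := le_of_lt ((norm_nonneg _).trans_lt (hA ⟨p.src, p.μ⟩ ⟨h1, h2⟩))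
  -- the curl of `A₀ + G` is the curl of `A₀`, bounded by two stencil letters
  have q1 : ((p.src, p.μ, p.ν) : Site P 0 × Fin P.d × Fin P.d) ∈ (Sect2.regionOfSet P Y).dpairs := ⟨h1, h2, h3, h4⟩
  have h4' : (p.src.shift p.ν).shift p.μ ∈ Y := by rw [shift_shift_comm]; exact h4
  have q2 : ((p.src, p.ν, p.μ) : Site P 0 × Fin P.d × Fin P.d) ∈ (Sect2.regionOfSet P Y).dpairs := ⟨h1, h3, h2, h4'⟩
  have e1 : ‖grad ξ p.μ (fun z => A₀ ⟨z, p.ν⟩) p.src‖ < t₀ := by simpa only using hdA₀ (p.src, p.μ, p.ν) q1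
  have e2 : ‖grad ξ p.ν (fun z => A₀ ⟨z, p.μ⟩) p.src‖ < t₀ := by simpa only using hdA₀ (p.src, p.ν, p.μ) q2
  have hcurl : ‖Sect2.curlA ξ (A₀ + G) p.src p.μ p.ν‖ < 2 * t₀ := by
    rw [curlA_add_eq_of_curlFree ξ A₀ hG, Sect2.curlA]
    calc ‖grad ξ p.μ (fun z => A₀ ⟨z, p.ν⟩) p.src - grad ξ p.ν (fun z => A₀ ⟨z, p.μ⟩) p.src‖
        ≤ ‖grad ξ p.μ (fun z => A₀ ⟨z, p.ν⟩) p.src‖ + ‖grad ξ p.ν (fun z => A₀ ⟨z, p.μ⟩) p.src‖ := norm_sub_le _ _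
      _ < t₀ + t₀ := add_lt_add e1 e2
      _ = 2 * t₀ := by ring
  have htail := expTail_two_budget hξ hξ1 ht0 ht
  have hξ2 : 0 < ξ ^ 2 := by positivity
  calc dist1 (GaugeField.plaqHol U p) ≤ ξ ^ 2 * ‖Sect2.curlA ξ (A₀ + G) p.src p.μ p.ν‖ + expTail 2 (4 * (ξ * t)) := hmain
    _ < ξ ^ 2 * (2 * t₀) + 24 * t ^ 2 * ξ ^ 2 := add_lt_add_of_lt_of_le (mul_lt_mul_of_pos_left hcurl hξ2) htail
    _ = (2 * t₀ + 24 * t ^ 2) * ξ ^ 2 := by ring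

end Plaquette

/-! ## §3  The co-divergence member (1.9) under a curl-free shift -/

section CoDivergence

variable [NeZero N]

/-- ★★ **THE CO-DIVERGENCE MEMBER UNDER A CURL-FREE SHIFT**: with the gauge equation for `A₀ + G` on the bonds of `Y`, `G` curl-free, `‖A₀ + G‖ < t` on the bonds, `‖∇^ξ(A₀ + G)‖ < t`
on the derivative pairs, `‖∂^{ξ*}∂^ξA₀‖ < t₀` on the deep bonds, `0 < ξ ≤ 1`, `32t ≤ 1`: `‖η·(D*∂U)(b)‖ < (t₀ + 32·d·t²)·ξ³` on `Sect2.bondsDeep Y` — module 33c's (1.54) estimate, whose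
linear term `ξ³‖∂^{ξ*}∂^ξ(A₀ + G)‖` is `ξ³‖∂^{ξ*}∂^ξA₀‖`. [cite: Balaban1985Variational, (168) p.304, (2) p.278; Balaban1985RegularSpaces, (1.2) p.76, (1.54) p.85, (1.140)–(1.142) p.100] -/
theorem norm_coDivSum_lt_of_curlFree_shift {Y : Set (Site P 0)} {ξ t t₀ : ℝ} {u : GaugeTransf P 0 (SU N)} {U : GaugeField P 0 (SU N)} {A₀ G : PBond P 0 → MatA N}
    (he : ∀ b ∈ (Sect2.regionOfSet P Y).bonds, gaugeU (fun x => ιSU N (u x)) (fun b' => ιSU N (U b')) b = expI ξ ((A₀ + G) b))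
    (hG : ∀ (y : Site P 0) (ν μ : Fin P.d), Sect2.curlA ξ G y ν μ = 0)
    (hA : ∀ b ∈ (Sect2.regionOfSet P Y).bonds, ‖(A₀ + G) b‖ < t)
    (hdA : ∀ q ∈ (Sect2.regionOfSet P Y).dpairs, ‖grad ξ q.2.1 (fun y => (A₀ + G) ⟨y, q.2.2⟩) q.1‖ < t)
    (h10 : ∀ b ∈ Sect2.bondsDeep Y, ‖Sect2.codiffCurlA ξ A₀ b.src b.dir‖ < t₀)
    (hξ : 0 < ξ) (hξ1 : ξ ≤ 1) (ht : 32 * t ≤ 1) {b : PBond P 0} (hb : b ∈ Sect2.bondsDeep Y) :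
    ‖Sect2.coDivSum U b.src b.dir‖ < (t₀ + 32 * P.d * t ^ 2) * ξ ^ 3 := by
  have hm := Sect2.norm_coDivSum_le_of_localGauge_letters u (A₀ + G) he hA hdA hξ hξ1 ht hb
  rw [codiffCurlA_add_eq_of_curlFree ξ A₀ hG] at hm
  have hξ3 : 0 < ξ ^ 3 := pow_pos hξ 3
  have hlin : ξ ^ 3 * ‖Sect2.codiffCurlA ξ A₀ b.src b.dir‖ < ξ ^ 3 * t₀ := mul_lt_mul_of_pos_left (h10 b hb) hξ3
  calc ‖Sect2.coDivSum U b.src b.dir‖ ≤ ξ ^ 3 * ‖Sect2.codiffCurlA ξ A₀ b.src b.dir‖ + P.d * (32 * ξ ^ 3 * t ^ 2) := hm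
    _ < ξ ^ 3 * t₀ + P.d * (32 * ξ ^ 3 * t ^ 2) := add_lt_add_of_lt_of_le hlin le_rfl
    _ = (t₀ + 32 * P.d * t ^ 2) * ξ ^ 3 := by ring

end CoDivergence

/-! ## §4  Both members of the class (2) inside `Y` under a curl-free shift -/

section RegularTwo

variable [NeZero N]

/-- ★★★ **BOTH MEMBERS OF (2) INSIDE `Y` WHEN THE POTENTIAL CARRIES A CURL-FREE SUMMAND** — the pure-gauge-shift twin of 33c's `Sect2.regularTwo_of_localGauge10On`: if
`(ι∘U)^{ι∘u} = e^{iξ(A₀ + G)}` on the bonds of `Y` with `∂^ξG = 0`, the FULL potential has `‖A₀ + G‖ < t` on the bonds and `‖∇^ξ(A₀ + G)‖ < t` on the derivative pairs, and print's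
part has `‖∇^ξA₀‖ < t₀` on the pairs and `‖∂^{ξ*}∂^ξA₀‖ < t₀` on the deep bonds (`0 < ξ ≤ 1`, `32t ≤ 1`), then
`PlaqSmallOn (plaqInside Y) ((2t₀ + 24t²)·ξ²) U ∧ Sect2.CoDivSmallOn (bondsDeep Y) ((t₀ + 32·d·t²)·ξ³) U` — (168)'s two gauge-invariant norms see `G` only through `t²`.
[cite: Balaban1985Variational, (2) p.278, (168) p.304; Balaban1985RegularSpaces, (1.7)–(1.9) p.77, (1.54) p.85, Prop. 7 (1.144) p.100] -/
theorem regularTwo_of_curlFreeShift {Y : Set (Site P 0)} {ξ t t₀ : ℝ} {U : GaugeField P 0 (SU N)}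
    (u : GaugeTransf P 0 (SU N)) (A₀ G : PBond P 0 → MatA N)
    (he : ∀ b ∈ (Sect2.regionOfSet P Y).bonds, gaugeU (fun x => ιSU N (u x)) (fun b' => ιSU N (U b')) b = expI ξ ((A₀ + G) b))
    (hG : ∀ (y : Site P 0) (ν μ : Fin P.d), Sect2.curlA ξ G y ν μ = 0)
    (hA : ∀ b ∈ (Sect2.regionOfSet P Y).bonds, ‖(A₀ + G) b‖ < t)
    (hdA : ∀ q ∈ (Sect2.regionOfSet P Y).dpairs, ‖grad ξ q.2.1 (fun y => (A₀ + G) ⟨y, q.2.2⟩) q.1‖ < t)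
    (hdA₀ : ∀ q ∈ (Sect2.regionOfSet P Y).dpairs, ‖grad ξ q.2.1 (fun y => A₀ ⟨y, q.2.2⟩) q.1‖ < t₀)
    (h10 : ∀ b ∈ Sect2.bondsDeep Y, ‖Sect2.codiffCurlA ξ A₀ b.src b.dir‖ < t₀)
    (hξ : 0 < ξ) (hξ1 : ξ ≤ 1) (ht : 32 * t ≤ 1) :
    PlaqSmallOn (plaqInside Y) ((2 * t₀ + 24 * t ^ 2) * ξ ^ 2) U ∧
      Sect2.CoDivSmallOn (Sect2.bondsDeep Y) ((t₀ + 32 * P.d * t ^ 2) * ξ ^ 3) U :=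
  ⟨fun _ hp => dist1_plaqHol_lt_of_curlFree_shift he hG hA hdA₀ hξ hξ1 ht hp,
    fun _ hb => norm_coDivSum_lt_of_curlFree_shift he hG hA hdA h10 hξ hξ1 ht hb⟩

/-- **THE GRADIENT INSTANCE** (`G⟨z, κ⟩ = ∇^ξ_κ m(z)` for a site function `m`, e.g. road R0′'s fine pure gauge `∂μ = H(∂_cλ)` — dag-n07-w7 `…N07FlatHOfCoarseGradient`): the same
conclusion with the curl-freeness supplied by `curlA_gradPot_eq_zero`. [cite: Balaban1985Variational, (168) p.304, (2) p.278; Balaban1985RegularSpaces, (1.54) p.85] -/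
theorem regularTwo_of_gradShift {Y : Set (Site P 0)} {ξ t t₀ : ℝ} {U : GaugeField P 0 (SU N)}
    (u : GaugeTransf P 0 (SU N)) (A₀ : PBond P 0 → MatA N) (m : Site P 0 → MatA N)
    (he : ∀ b ∈ (Sect2.regionOfSet P Y).bonds,
      gaugeU (fun x => ιSU N (u x)) (fun b' => ιSU N (U b')) b = expI ξ ((A₀ + fun b' : PBond P 0 => grad ξ b'.dir m b'.src) b))
    (hA : ∀ b ∈ (Sect2.regionOfSet P Y).bonds, ‖(A₀ + fun b' : PBond P 0 => grad ξ b'.dir m b'.src) b‖ < t)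
    (hdA : ∀ q ∈ (Sect2.regionOfSet P Y).dpairs, ‖grad ξ q.2.1 (fun y => (A₀ + fun b' : PBond P 0 => grad ξ b'.dir m b'.src) ⟨y, q.2.2⟩) q.1‖ < t)
    (hdA₀ : ∀ q ∈ (Sect2.regionOfSet P Y).dpairs, ‖grad ξ q.2.1 (fun y => A₀ ⟨y, q.2.2⟩) q.1‖ < t₀)
    (h10 : ∀ b ∈ Sect2.bondsDeep Y, ‖Sect2.codiffCurlA ξ A₀ b.src b.dir‖ < t₀)
    (hξ : 0 < ξ) (hξ1 : ξ ≤ 1) (ht : 32 * t ≤ 1) :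
    PlaqSmallOn (plaqInside Y) ((2 * t₀ + 24 * t ^ 2) * ξ ^ 2) U ∧
      Sect2.CoDivSmallOn (Sect2.bondsDeep Y) ((t₀ + 32 * P.d * t ^ 2) * ξ ^ 3) U :=
  regularTwo_of_curlFreeShift u A₀ (fun b' : PBond P 0 => grad ξ b'.dir m b'.src) he (curlA_gradPot_eq_zero ξ m) hA hdA hdA₀ h10 hξ hξ1 ht

end RegularTwo

end Summit.QuantumFields.YangMills.BalabanUVNodes.N07PureGaugeShift168

end
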